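import Summits.QuantumFields.YangMills.Theorems.LuscherReductionTwistedTraceScalingToronSlowModes
import Summits.QuantumFields.YangMills.Theorems.LuscherReductionTwistedTraceScalingToronOrbitSpectrum
import Summits.QuantumFields.YangMills.Theorems.TwistedTraceScaling.Negative.ToronCellGap
import HarnessLib

/-!
# The toron CELL: centre twists do not move the covariant curl, every flat background is gauge × twist equivalent to one in the trivial cell
# `|θ_k| ≤ π/(2L)`, and there the stiff remainder of the zero-point sum is uniformly gapped
# (lane A of S-BASE, crux `TwistedTraceScaling` stmt-QuantumFields-20203; answer to the disprover's R9 `Negative/ToronCellGap`, design note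
# `pub/ym-fleet/ym-luscher-20007-p1/COARSE-DESIGN.md` §15)

The disprover (cdisprove-20203-1 g9, `R9.lap3_halfTwist_eq_zero`, `R9.not_uniform_gap`) showed that the Born–Oppenheimer split «slow = `slowModes θ`
(nine zero-momentum modes), fast = the rest» of `…ToronSlowModes` has an exact zero mode in its FAST window at the non-trivial toron point
`θ⋆ = (0,0,π/L)`, and that the remainder `restZPE L κ (2θ)` is uniformly gapped only on the trivial cell `|2θ_k| ≤ π/L` (`R9.cell_gap_le_lap3`).  This
file makes the repair formal: the valley coordinate may ALWAYS be taken in the trivial cell.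
* §1 `adRot_centreElem`, ★ `covCurl_twist3 : covCurl (τ_z U) = covCurl U` — the covariant curl factors through `Ad : SU(2) → SO(3)`, which kills the
  centre; so every spectral datum of `‖D_U·‖²` (lane B's Gram matrix, lane A's frames) is twist-INVARIANT, not only gauge-covariant.
* §2 `exists_cell_rep : ∀ θ, ∃ n : ℤ³, ∀ k, |θ_k − n_kπ/L| ≤ π/(2L)`.
* §3 ★ `Frame.IsDiag.cellShift` — with `z` the parity bits of `n` (`gaugeTransform_stairGauge_abelianCfg`: `g_n·V_θ = τ_z V_{θ−nπ/L}`), a frame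
  diagonalising `‖D_{V_θ}·‖²` is transported by the staircase gauge rotation to a frame diagonalising `‖D_{V_{θ−nπ/L}}·‖²` with the SAME values; hence
  (`sum_eq_sum_cellShift`) all spectral sums agree, and ★★ `exists_isDiag_cell`: for every `θ` and every diagonalising frame at `V_θ` there are a cell
  representative `θ'` (`|θ'_k| ≤ π/(2L)`) and a diagonalising frame at `V_{θ'}` with the same index type and the same values.
* §4 ★★ `sum_modeZPE_eq_cell`: for every frame at `V_θ`, `Σᵢ modeZPE(κaᵢ) = 2·toronZPE L κ 0 0 + 4·zeroModeZPE κ (2θ') + 4·restZPE L κ (2θ')` with `θ'`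
  in the cell, where EVERY remainder term is stiff: `modeZPE(κ(2 − 2cos(π/L))) ≤ modeZPE(κ·lap3 L (2θ') j)`, `j ≠ 0` (`restZPE_cell_term_ge`, from R9) and
  `restZPE L κ (2θ') ≥ (L³ − 1)·modeZPE(κ(2 − 2cos(π/L)))` (`restZPE_cell_ge`).
So the BO split of `…ToronSlowModes` / `…ToronValleyStepBO` is to be used at the cell representative `θ'` of the valley coordinate (slow = the transported
`slowModes θ'`), and the other `8^… − 1` cells are reached by gauge × twist — under which `S`, `orbitDist ∘ τ`, `covCurl` and every `IsPhys` test function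
are invariant.  HONEST FRAMING: finite-dimensional bookkeeping for a stub lane of a child of the CONDITIONAL reduction route (femto rung R2b1); not Clay.
-/

set_option autoImplicit false

noncomputable section

open Finset Real
open scoped BigOperators RealInnerProductSpace
open Literature.MathematicalPhysics.QuantumFieldTheory
open Literature.MathematicalPhysics.QuantumLattice
open Summit.QuantumFields.YangMills.Theorems.TwistedTraceScaling.Negative

namespace Summit.QuantumFields.YangMills.Theorems.FemtoTransferGap.TwoLattice.Toron

open Summit.QuantumFields.YangMills.Theorems.FemtoTransferGap
open Summit.QuantumFields.YangMills.Theorems.FemtoTransferGap.TwoLattice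
open Summit.QuantumFields.YangMills.Theorems.FemtoTransferGap.TwoLattice.Stiff
open Summit.QuantumFields.YangMills.Theorems.FemtoTransferGap.TwoLattice.Cov

variable (L : ℕ) [NeZero L]

/-! ## §1 Centre twists do not move the covariant curl -/

omit [NeZero L] in
/-- `Ad(−1) = 1`: the adjoint representation kills the centre. [cite: BrockerTomDieck1985, I (1.10)] -/
theorem adRot_negOne : adRot negOne = 1 := by
  have h00 : (((negOne : SU2) : Matrix (Fin 2) (Fin 2) ℂ) 0 0) = -1 := by
    rw [show ((negOne : SU2) : Matrix (Fin 2) (Fin 2) ℂ) = -1 from rfl]; simp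
  have h01 : (((negOne : SU2) : Matrix (Fin 2) (Fin 2) ℂ) 0 1) = 0 := by
    rw [show ((negOne : SU2) : Matrix (Fin 2) (Fin 2) ℂ) = -1 from rfl]; simp
  unfold adRot
  simp only [h00, h01, Complex.neg_re, Complex.neg_im, Complex.one_re, Complex.one_im, Complex.zero_re, Complex.zero_im, neg_zero]
  ext i j
  fin_cases i <;> fin_cases j <;> norm_num

omit [NeZero L] in
/-- `Ad(z) = 1` for both centre elements. [cite: BrockerTomDieck1985, I (1.10)] -/
theorem adRot_centreElem (b : Bool) : adRot (TT.centreElem b) = 1 := by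
  cases b
  · simp only [TT.centreElem]; exact adRot_one
  · simp only [TT.centreElem, if_true]; exact adRot_negOne

omit [NeZero L] in
/-- `Ad(z·A) = Ad(A)` for a centre element `z`. [folklore] -/
theorem adRot_centreElem_mul (b : Bool) (A : SU2) : adRot (TT.centreElem b * A) = adRot A := by
  rw [adRot_mul, adRot_centreElem, one_mul]

omit [NeZero L] in
/-- Link by link, the twisted configuration has the same adjoint rotations. [folklore] -/
theorem adRot_twist3_apply (z : Fin 3 → Bool) (U : GaugeConfig 3 L SU2) (e : Edge 3 L) : adRot (TT.twist3 z U e) = adRot (U e) := by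
  rw [TT.twist3_apply, adRot_mul]
  split_ifs
  · rw [adRot_centreElem, one_mul]
  · rw [adRot_one, one_mul]

omit [NeZero L] in
/-- The plaquette holonomies are twist invariant. [cite: tHooft1979] -/
theorem hol_twist3 (z : Fin 3 → Bool) (U : GaugeConfig 3 L SU2) (p : Plaquette 3 L) : hol (TT.twist3 z U) p = hol U p := by
  simp only [hol, TT.twist3]
  rw [plaquetteHolonomy_twist_of_mem_center 0 (TT.centreElem_mem_center (z 0)) _ p.1 (ne_of_lt p.2.2),
    plaquetteHolonomy_twist_of_mem_center 1 (TT.centreElem_mem_center (z 1)) _ p.1 (ne_of_lt p.2.2),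
    plaquetteHolonomy_twist_of_mem_center 2 (TT.centreElem_mem_center (z 2)) _ p.1 (ne_of_lt p.2.2)]

omit [NeZero L] in
/-- The adjoint rotations of the partial holonomies are twist invariant. [folklore] -/
theorem adRot_ptrans_twist3 (z : Fin 3 → Bool) (U : GaugeConfig 3 L SU2) (p : Plaquette 3 L) :
    adRot (ptrans1 (TT.twist3 z U) p) = adRot (ptrans1 U p) ∧ adRot (ptrans2 (TT.twist3 z U) p) = adRot (ptrans2 U p) := by
  refine ⟨adRot_twist3_apply L z U _, ?_⟩
  simp only [ptrans2]
  rw [adRot_mul, adRot_mul, adRot_inv, adRot_twist3_apply, adRot_twist3_apply, adRot_twist3_apply, ← adRot_inv, ← adRot_mul, ← adRot_mul]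

omit [NeZero L] in
/-- ★ **The covariant curl is twist invariant**: `D_{τ_z U} = D_U` (the linearised curvature sees the links only through `Ad`). [cite: tHooft1979] [cite: Luscher1983, §3] -/
theorem covCurl_twist3 (z : Fin 3 → Bool) (U : GaugeConfig 3 L SU2) : covCurl (TT.twist3 z U) = covCurl U := by
  apply LinearMap.ext; intro w
  ext ⟨⟨x, ij⟩, a⟩
  obtain ⟨h1, h2⟩ := adRot_ptrans_twist3 L z U (x, ij)
  rw [covCurl_apply, covCurl_apply, h1, h2, hol_twist3]

/-- Hence diagonalising frames of `‖D_U·‖²` are diagonalising frames of `‖D_{τ_z U}·‖²` with the same values. [folklore] -/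
theorem Frame.IsDiag.twist3 {ι : Type*} [Fintype ι] [DecidableEq ι] {U : GaugeConfig 3 L SU2} {e : OrthonormalBasis ι ℝ (LinkSpace L)} {a : ι → ℝ}
    (h : Frame.IsDiag (covCurl U) e a) (z : Fin 3 → Bool) : Frame.IsDiag (covCurl (TT.twist3 z U)) e a := by
  rwa [covCurl_twist3]

/-! ## §2 Every angle has a representative in the trivial cell -/

/-- ★ **Cell representative**: for every `θ` there is `n ∈ ℤ³` with `|θ_k − n_kπ/L| ≤ π/(2L)` for all `k` (`n_k = round(Lθ_k/π)`). [folklore] -/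
theorem exists_cell_rep (θ : Fin 3 → ℝ) : ∃ n : Fin 3 → ℤ, ∀ k, |θ k - n k * Real.pi / L| ≤ Real.pi / (2 * L) := by
  have hL : (0 : ℝ) < L := by exact_mod_cast Nat.pos_of_ne_zero (NeZero.ne L)
  have hc : 0 < Real.pi / L := by positivity
  refine ⟨fun k => round (θ k * L / Real.pi), fun k => ?_⟩
  have h := abs_sub_round (θ k * L / Real.pi)
  have e : θ k - (round (θ k * L / Real.pi) : ℝ) * Real.pi / L = (θ k * L / Real.pi - round (θ k * L / Real.pi)) * (Real.pi / L) := by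
    field_simp
  rw [e, abs_mul, abs_of_pos hc]
  calc |θ k * L / Real.pi - round (θ k * L / Real.pi)| * (Real.pi / L) ≤ 1 / 2 * (Real.pi / L) := mul_le_mul_of_nonneg_right h hc.le
    _ = Real.pi / (2 * L) := by field_simp

/-- In the cell the ADJOINT phases satisfy `|2θ'_k| ≤ π/L` — the hypothesis of `R9.cell_gap_le_lap3`. [folklore] -/
theorem abs_two_mul_le_of_cell {θ' : Fin 3 → ℝ} (h : ∀ k, |θ' k| ≤ Real.pi / (2 * L)) (k : Fin 3) : |2 * θ' k| ≤ Real.pi / L := by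
  have hL : (0 : ℝ) < L := by exact_mod_cast Nat.pos_of_ne_zero (NeZero.ne L)
  rw [abs_mul, abs_two]
  have := h k
  rw [le_div_iff₀ (by positivity)] at this
  rw [le_div_iff₀ hL]
  linarith

/-! ## §3 Transport of diagonalising frames to the cell -/

/-- ★ **Cell shift of a diagonalising frame**: if `(e, a)` diagonalises `‖D_{V_θ}·‖²` and `z` are the parity bits of `n` (`diagSU2(n_kπ) = centreElem z_k`), then
the staircase-rotated frame diagonalises `‖D_{V_{θ − nπ/L}}·‖²` with the SAME values (`g_n·V_θ = τ_z V_{θ−nπ/L}` and `D_{τ_z V} = D_V`). [cite: Luscher1983, §2–§3] -/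
theorem Frame.IsDiag.cellShift {ι : Type*} [Fintype ι] [DecidableEq ι] {θ : Fin 3 → ℝ} {e : OrthonormalBasis ι ℝ (LinkSpace L)} {a : ι → ℝ}
    (h : Frame.IsDiag (covCurl (abelianCfg L θ)) e a) (n : Fin 3 → ℤ) (z : Fin 3 → Bool) (hz : ∀ k, diagSU2 (n k * Real.pi) = TT.centreElem (z k)) :
    Frame.IsDiag (covCurl (abelianCfg L fun k => θ k - n k * Real.pi / L)) (rotFrame L (stairGauge n) e) a := by
  have h1 := h.rotate L (stairGauge n)
  rwa [gaugeTransform_stairGauge_abelianCfg θ n z hz, covCurl_twist3] at h1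

/-- Hence the spectral sums at `V_θ` and at `V_{θ − nπ/L}` agree: for ANY frames diagonalising the two forms and any `f`, `Σᵢ f(aᵢ) = Σⱼ f(a'ⱼ)`.
[cite: Luscher1983, §3] -/
theorem Frame.IsDiag.sum_eq_sum_cellShift {ι ι' : Type*} [Fintype ι] [DecidableEq ι] [Fintype ι'] [DecidableEq ι'] {θ : Fin 3 → ℝ}
    {e : OrthonormalBasis ι ℝ (LinkSpace L)} {a : ι → ℝ} (h : Frame.IsDiag (covCurl (abelianCfg L θ)) e a) (n : Fin 3 → ℤ)
    {e' : OrthonormalBasis ι' ℝ (LinkSpace L)} {a' : ι' → ℝ} (h' : Frame.IsDiag (covCurl (abelianCfg L fun k => θ k - n k * Real.pi / L)) e' a')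
    (f : ℝ → ℝ) : ∑ i, f (a i) = ∑ j, f (a' j) := by
  classical
  choose z hz using fun k => exists_diagSU2_int_mul_pi_eq_centreElem (n k)
  exact (h.cellShift L n z hz).sum_eq_sum h' f

/-- ★★ **Every flat background has a cell representative with the same spectral data**: for every `θ` and every frame `(e, a)` diagonalising `‖D_{V_θ}·‖²`
there are `θ'` with `|θ'_k| ≤ π/(2L)` (so `|2θ'_k| ≤ π/L`), integers `n` with `θ' = θ − nπ/L`, and a frame with the same index type and the SAME values `a`
diagonalising `‖D_{V_{θ'}}·‖²`. [cite: Luscher1983, §2–§3] -/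
theorem exists_isDiag_cell {ι : Type*} [Fintype ι] [DecidableEq ι] {θ : Fin 3 → ℝ} {e : OrthonormalBasis ι ℝ (LinkSpace L)} {a : ι → ℝ}
    (h : Frame.IsDiag (covCurl (abelianCfg L θ)) e a) :
    ∃ (n : Fin 3 → ℤ) (θ' : Fin 3 → ℝ) (e' : OrthonormalBasis ι ℝ (LinkSpace L)),
      (θ' = fun k => θ k - n k * Real.pi / L) ∧ (∀ k, |θ' k| ≤ Real.pi / (2 * L)) ∧ Frame.IsDiag (covCurl (abelianCfg L θ')) e' a := by
  classical
  obtain ⟨n, hn⟩ := exists_cell_rep L θ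
  choose z hz using fun k => exists_diagSU2_int_mul_pi_eq_centreElem (n k)
  exact ⟨n, fun k => θ k - n k * Real.pi / L, rotFrame L (stairGauge n) e, rfl, hn, h.cellShift L n z hz⟩

/-! ## §4 The zero-point sum of any flat background in cell form, with the uniform remainder gap -/

/-- Every remainder term is stiff on the cell: `|θ'_k| ≤ π/(2L)`, `j ≠ 0`, `κ ≥ 0`, `L ≥ 2` ⇒ `modeZPE(κ(2 − 2cos(π/L))) ≤ modeZPE(κ·lap3 L (2θ') j)`.
[folklore] -/
theorem restZPE_cell_term_ge (hL : 2 ≤ L) {κ : ℝ} (hκ : 0 ≤ κ) {θ' : Fin 3 → ℝ} (hθ' : ∀ k, |θ' k| ≤ Real.pi / (2 * L)) {j : Fin 3 → Fin L}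
    (hj : j ≠ 0) : modeZPE (κ * (2 - 2 * Real.cos (Real.pi / L))) ≤ modeZPE (κ * lap3 L (fun k => 2 * θ' k) j) :=
  R9.modeZPE_cell_gap_le L hL hκ (fun k => abs_two_mul_le_of_cell L hθ' k) hj

/-- ★ **Uniform stiffness of the remainder on the cell**: `restZPE L κ (2θ') ≥ (L³ − 1)·modeZPE(κ(2 − 2cos(π/L)))` for `|θ'_k| ≤ π/(2L)`. [folklore] -/
theorem restZPE_cell_ge (hL : 2 ≤ L) {κ : ℝ} (hκ : 0 ≤ κ) {θ' : Fin 3 → ℝ} (hθ' : ∀ k, |θ' k| ≤ Real.pi / (2 * L)) :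
    ((L : ℝ) ^ 3 - 1) * modeZPE (κ * (2 - 2 * Real.cos (Real.pi / L))) ≤ restZPE L κ (fun k => 2 * θ' k) := by
  unfold restZPE
  have hcard : (((univ : Finset (Fin 3 → Fin L)).erase 0).card : ℝ) = (L : ℝ) ^ 3 - 1 := by
    rw [card_erase_of_mem (mem_univ _), card_univ, Fintype.card_pi, prod_const, card_univ, Fintype.card_fin, Fintype.card_fin]
    have h1 : 1 ≤ L ^ 3 := Nat.one_le_pow _ _ (by omega)
    push_cast [Nat.cast_sub h1]
    ring
  calc ((L : ℝ) ^ 3 - 1) * modeZPE (κ * (2 - 2 * Real.cos (Real.pi / L)))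
      = ∑ _j ∈ (univ : Finset (Fin 3 → Fin L)).erase 0, modeZPE (κ * (2 - 2 * Real.cos (Real.pi / L))) := by
        rw [sum_const, nsmul_eq_mul, hcard]
    _ ≤ ∑ j ∈ (univ : Finset (Fin 3 → Fin L)).erase 0, modeZPE (κ * lap3 L (fun k => 2 * θ' k) j) :=
        sum_le_sum fun j hj => restZPE_cell_term_ge L hL hκ hθ' (ne_of_mem_erase hj)

/-- ★★ **The zero-point sum of ANY flat background, in cell form**: for every `θ` and every orthonormal frame `(e, a)` diagonalising `‖D_{V_θ}·‖²` there is a cell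
representative `θ' = θ − nπ/L`, `|θ'_k| ≤ π/(2L)`, with `Σᵢ modeZPE(κaᵢ) = 2·toronZPE L κ 0 0 + 4·zeroModeZPE κ (2θ') + 4·restZPE L κ (2θ')` — the one-site
(slow) term at `θ'` plus a remainder each of whose `L³ − 1` terms is at least `modeZPE(κ(2 − 2cos(π/L)))`. [cite: Luscher1983, §3] -/
theorem sum_modeZPE_eq_cell {ι : Type*} [Fintype ι] [DecidableEq ι] {θ : Fin 3 → ℝ} {e : OrthonormalBasis ι ℝ (LinkSpace L)} {a : ι → ℝ}
    (h : Frame.IsDiag (covCurl (abelianCfg L θ)) e a) (κ : ℝ) :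
    ∃ (n : Fin 3 → ℤ) (θ' : Fin 3 → ℝ), (θ' = fun k => θ k - n k * Real.pi / L) ∧ (∀ k, |θ' k| ≤ Real.pi / (2 * L)) ∧
      ∑ i, modeZPE (κ * a i) = 2 * toronZPE L κ 0 0 + 4 * zeroModeZPE κ (fun k => 2 * θ' k) + 4 * restZPE L κ (fun k => 2 * θ' k) := by
  classical
  obtain ⟨n, θ', e', hθ', hcell, h'⟩ := exists_isDiag_cell L h
  refine ⟨n, θ', hθ', hcell, ?_⟩
  rw [sum_modeZPE_of_isDiag_covCurl_abelianCfg L θ' h' κ, toronZPE_eq_zeroModeZPE_add_restZPE L κ (fun k => 2 * θ' k)]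
  ring

open scoped Classical in
/-- ★ **The adapted BO split transported to any background**: for every `θ` there are a cell representative `θ'` and an orthonormal eigenframe of
`‖D_{V_θ}·‖²` (values `‖D_{V_θ} eᵢ‖²`) whose vectors are the staircase-rotations of a frame at `V_{θ'}` adapted to `slowModes L θ'`; its slow vectors carry
`4·zeroModeZPE κ (2θ')` and its fast vectors `2·toronZPE L κ 0 0 + 4·restZPE L κ (2θ')`. [cite: Luscher1983, §3] -/
theorem exists_adapted_cell (θ : Fin 3 → ℝ) (κ : ℝ) :
    ∃ (n : Fin 3 → ℤ) (θ' : Fin 3 → ℝ) (m : ℕ) (e' : OrthonormalBasis (Fin m) ℝ (LinkSpace L)),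
      (θ = fun k => θ' k - (-n) k * Real.pi / L) ∧ (∀ k, |θ' k| ≤ Real.pi / (2 * L)) ∧
      Frame.IsDiag (covCurl (abelianCfg L θ')) e' (fun i => ‖covCurl (abelianCfg L θ') (e' i)‖ ^ 2) ∧
      (∀ i, e' i ∈ slowModes L θ' ∨ e' i ∈ (slowModes L θ')ᗮ) ∧
      Frame.IsDiag (covCurl (abelianCfg L θ)) (rotFrame L (stairGauge (-n)) e') (fun i => ‖covCurl (abelianCfg L θ') (e' i)‖ ^ 2) ∧
      ∑ i : {i : Fin m // e' i ∈ slowModes L θ'}, modeZPE (κ * ‖covCurl (abelianCfg L θ') (e' (i : Fin m))‖ ^ 2) = 4 * zeroModeZPE κ (fun k => 2 * θ' k) ∧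
      ∑ i : {i : Fin m // ¬ e' i ∈ slowModes L θ'}, modeZPE (κ * ‖covCurl (abelianCfg L θ') (e' (i : Fin m))‖ ^ 2) =
        2 * toronZPE L κ 0 0 + 4 * restZPE L κ (fun k => 2 * θ' k) := by
  classical
  obtain ⟨n, hn⟩ := exists_cell_rep L θ
  set θ' : Fin 3 → ℝ := fun k => θ k - n k * Real.pi / L with hθ'
  obtain ⟨m, e', hdiag, hadapt⟩ := exists_isDiag_adapted_slowModes L θ'
  choose z hz using fun k => exists_diagSU2_int_mul_pi_eq_centreElem ((-n) k)
  have hθ : θ = fun k => θ' k - (-n) k * Real.pi / L := by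
    funext k; simp only [hθ', Pi.neg_apply, Int.cast_neg]; ring
  refine ⟨n, θ', m, e', hθ, hn, hdiag, hadapt, ?_, sum_modeZPE_slow_of_adapted L θ' hdiag hadapt κ, sum_modeZPE_fast_of_adapted L θ' hdiag hadapt κ⟩
  have h2 := hdiag.cellShift L (-n) z hz
  rwa [← hθ] at h2

end Summit.QuantumFields.YangMills.Theorems.FemtoTransferGap.TwoLattice.Toron

end
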